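import Literature.MathematicalPhysics.QuantumFieldTheory.BalabanImbrieJaffe1984to88.BIJ88Eq5134TwoSpecies

/-!
# `BalabanImbrieJaffe1984to88.BIJ88TwoSpeciesPolymerGas` — T. Bałaban, J. Imbrie, A. Jaffe, *Effective action and cluster properties of the
abelian Higgs model*, Commun. Math. Phys. **114** (1988) 257–315 [BalabanImbrieJaffe1988], §5.13 display (5.13.4) p. 306 [PDF 50] and §5.14
p. 308 [PDF 52]: **the resummed expansion (5.13.4) as a POLYMER GAS, I: the typed polymers and the bijection** — the structure which the step
of p. 308, verbatim *"We treat z_F(Λ₁₂^{(k)}) as follows: z_F(Λ₁₂^{(k)}) = (z_F(Λ₁₂^{(k)})/z(Λ₁₂^{(k)})) exp(log z(Λ₁₂^{(k)})), where z(Λ₁₂^{(k)}) =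
z_{F=1}(Λ₁₂^{(k)})"* … *"and we give expansions for z_F/z and log z"*, presupposes: `log z` is expanded when `z` is the partition function of a
gas of polymers subject to a PAIR incompatibility, with activities measured against a product background.

statement-level skeleton of published theorems with citation tags; proofs where landed; nothing here is a claim about the Yang–Mills mass gap

PDF held: `paper:balaban1988-cmp114-bij-abelian-higgs-effective-action` (journal page = PDF page + 256); p. 306 = PDF 50, p. 308 = PDF 52 (read as
images `renders/original-p050-x2.png`, `…p052-x2.png` of the p25 seat; text `p0050.txt`, `p0052.txt`).

**The print (verbatim).** p. 306 [PDF 50]: *"Σ_{S_Y}Σ_{S₅} e^{−V^{(k)}_{const}(Λ₈^{(k)})} Σ_{{X_α} filling Λ₁₀^{(k)}} Π_α g₁(X_α) =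
e^{−V^{(k)}_{const}(Λ₈^{(k)})} Σ_{{X_α}} Π_α g₂(X_α). (5.13.4) Here g₂(X_α) is obtained by summing over S_Y, S₅ compatible with X_α … g₂(X_α) =
Σ_{S_Y,S₅ compatible with X_α} g₁(X_α)."* p. 308 [PDF 52]: *"To extract the perturbative terms, we resum the decoupling and Mayer expansions in
Λ₁₂^{(k)}. … z_F(Λ₁₂^{(k)}) = (z_F(Λ₁₂^{(k)})/z(Λ₁₂^{(k)})) exp(log z(Λ₁₂^{(k)}))"*.

WHAT IS REPRODUCED (unit `lit-balaban-p25`, generation 9 of the Phase-2 proof seat p25; SKELETON rows `C2.Eq5.13.3-5.13.4` and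
`C2.Eq5.14.1-5.14.2`; HOME `run/shared/lean/pub/lit-balaban/lit-balaban-p25/`). The companion files of this seat established the HONEST form of the
right side of (5.13.4) (`BIJ88Eq5134TwoSpecies.exchange5134`): exchanging the Mayer sums with the sum over the fillings gives, on the cubes `W` of
Λ₁₀ with the `S`-independent joining sets `J₀` (rules (iii)–(iv) of p. 304) and their elementary regions `regions J₀ W`, the TWO-SPECIES sum
`Σ_{Q} Σ_{M ⊆ Q, hard core} Π_{X∈M} b(X) Π_{X∈Q∖M} a(X)` over the fillings `Q` of `W` by `J₀`-closed polymers and the sub-families `M` of polymers of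
species B (multi-region for their own Mayer data; `b = g₂ᴮ`) no two of which abut, the others being of species A (`a = g₂ᴬ`). THIS FILE sets up
its recasting as an abstract polymer gas in the sense of `Literature.Probability.LatticeModels.PolymerGas` (a finite family of polymers, a
reflexive symmetric incompatibility, sums over the pairwise compatible sub-families); the identities are the companion `BIJ88Eq5134PolymerGas`:
* §1 the gas: `Touch` (two sets of cubes abut), the closed polymers `cpolys` (nonempty `J₀`-closed sets of cubes), the TYPED POLYMERS `tpolys`
  (pairs `(X, τ)`, `τ = true` = species B on any closed polymer, `τ = false` = species A on the closed polymers that are NOT a single elementary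
  region — the single regions of species A are the monomer background), the incompatibility `tinc` (equal or overlapping supports, or both of
  species B and abutting; `tinc_refl`, `tinc_symm`), the uncovered regions `uncov`, the typed weight `twt a b`;
* §2 the bijection `toGas (Q, M)` / `(ofQ 𝒳, ofM 𝒳)` between two-species configurations (`Q` a filling by closed polymers, `M ⊆ Q` hard core) and
  compatible typed families, with its bookkeeping: `toGas_subset_tpolys`, `isCompatible_toGas`, `uncov_toGas` (the uncovered regions are the
  single-region polymers of species A), `ofQ_toGas`, `ofM_toGas`, `prod_toGas_mul` (the weights agree), `isSetPartition_ofQ`, `hardCore_ofM`,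
  `toGas_ofQ_ofM`.

**Reading note (GAPS.md G-C2-p25-03, continued).** The printed *"Σ_{{X_α}} Π_α g₂(X_α)"* suggests a ONE-species gas of disjoint polymers; the
honest bookkeeping (this seat, gens 8–9) needs two species with the extra B–B hard core *"no two multi-region polymers abut"*. Typed polymers with
the incompatibility `tinc` make this an ordinary polymer gas with a reflexive symmetric pair incompatibility, so the machinery the paper invokes
on p. 308 (ratio `z_F/z`, `exp(log z)`, the expansion (5.14.2) of `log z`) is available for it verbatim, abutting B-polymers being counted as
incompatible in the connectedness of the cluster expansion. NOT summit progress; NOT continuum; NOT Clay; no smallness of activities is asserted.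
Imports: `BIJ88Eq5134TwoSpecies` only (`Literature.Probability.LatticeModels.PolymerGas` is in its import closure); modifies nothing. Cell
`lit-balaban` Phase 2, seat p25 gen 9; rows C2.Eq5.13.3-5.13.4 / C2.Eq5.14.1-5.14.2 (owner r16, referee ref-5).
-/


open Finset
open Literature.Probability.LatticeModels (IsSetPartition setPartitions mem_setPartitions IsCompatible polymerPartitionFunction)
open Literature.MathematicalPhysics.QuantumFieldTheory.BalabanImbrieJaffe1984to88.BIJ88ElementaryRegions304
  (IsClosed region regions mem_region mem_region_self region_subset region_subset_of_isClosed isClosed_region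
   region_eq_of_mem isSetPartition_regions mem_regions region_mem_regions regions_restrict_region)
open Literature.MathematicalPhysics.QuantumFieldTheory.BalabanImbrieJaffe1984to88.BIJ88Resummation5141
  (polysIn mem_polysIn restrictTo mem_restrictTo g2)
open Literature.MathematicalPhysics.QuantumFieldTheory.BalabanImbrieJaffe1984to88.BIJ88PolymerRep5134 (IsAdmissible)
open Literature.MathematicalPhysics.QuantumFieldTheory.BalabanImbrieJaffe1984to88.BIJ88MayerExchange5134
  (radj HardCore localI IsMulti gA gB not_isMulti_iff isClosed_union_iff restrictTo_union)
open Literature.MathematicalPhysics.QuantumFieldTheory.BalabanImbrieJaffe1984to88.BIJ88Eq5134TwoSpecies (exchange5134)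

namespace Literature.MathematicalPhysics.QuantumFieldTheory.BalabanImbrieJaffe1984to88.BIJ88TwoSpeciesPolymerGas

variable {ι : Type*} [DecidableEq ι]

/-! ## §1 The typed polymer gas -/

section Gas

variable (adj : ι → ι → Prop) [DecidableRel adj] (J₀ : Finset (Finset ι)) (W : Finset ι)

/-- **two sets of cubes ABUT**: some cube of one is adjacent (in either direction of `adj`) to some cube of the other — the relation excluded
between two multi-region polymers by the hard core of the honest form of (5.13.4). [cite: BalabanImbrieJaffe1988, (5.13.4) p.306] -/
def Touch (X X' : Finset ι) : Prop := ∃ a ∈ X, ∃ b ∈ X', adj a b ∨ adj b a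

/-- abutting is decidable. [cite: BalabanImbrieJaffe1988, (5.13.4) p.306] -/
instance instDecidableRelTouch : DecidableRel (Touch adj) := fun X X' =>
  inferInstanceAs (Decidable (∃ a ∈ X, ∃ b ∈ X', adj a b ∨ adj b a))

/-- **the closed polymers**: the nonempty sets of cubes of `W` closed under the `S`-independent merging rules `J₀` (rules (iii)–(iv) of p. 304),
i.e. the nonempty unions of elementary regions — the possible members `X_α` of a filling in the honest form of (5.13.4).
[cite: BalabanImbrieJaffe1988, (5.13.4) p.306] -/
def cpolys : Finset (Finset ι) := W.powerset.filter fun X => X.Nonempty ∧ IsClosed J₀ W X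

/-- **the TYPED POLYMERS of the resummed expansion**: pairs `(X, τ)` of a closed polymer and a species, `τ = true` (species B, weight `g₂ᴮ`) on
any closed polymer, `τ = false` (species A, weight `g₂ᴬ`) only on the closed polymers which are NOT a single elementary region — a single region of
species A is not a polymer but part of the background (the normalization `z` of p. 308 restricted to one region).
[cite: BalabanImbrieJaffe1988, (5.13.4) p.306] -/
def tpolys : Finset (Finset ι × Bool) :=
  (cpolys J₀ W ×ˢ (univ : Finset Bool)).filter fun p => p.2 = true ∨ p.1 ∉ regions J₀ W

/-- **the INCOMPATIBILITY of typed polymers**: equal or overlapping supports (the `X_α` of a filling are disjoint), or both of species B and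
abutting (the hard core of the honest form of (5.13.4)). Reflexive and symmetric (`tinc_refl`, `tinc_symm`), as the abstract polymer gas
`Literature.Probability.LatticeModels.PolymerGas` requires. [cite: BalabanImbrieJaffe1988, (5.13.4) p.306] -/
def tinc (p q : Finset ι × Bool) : Prop :=
  p.1 = q.1 ∨ ¬ Disjoint p.1 q.1 ∨ (p.2 = true ∧ q.2 = true ∧ Touch adj p.1 q.1)

/-- the incompatibility is decidable. [cite: BalabanImbrieJaffe1988, (5.13.4) p.306] -/
instance instDecidableRelTinc : DecidableRel (tinc adj) := fun p q =>
  inferInstanceAs (Decidable (p.1 = q.1 ∨ ¬ Disjoint p.1 q.1 ∨ (p.2 = true ∧ q.2 = true ∧ Touch adj p.1 q.1)))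

/-- **the UNCOVERED elementary regions** of a typed family: the regions disjoint from every support — the monomers of the background.
[cite: BalabanImbrieJaffe1988, (5.13.4) p.306] -/
def uncov (𝒳 : Finset (Finset ι × Bool)) : Finset (Finset ι) := (regions J₀ W).filter fun E => ∀ p ∈ 𝒳, Disjoint E p.1

variable {R : Type*} [CommRing R]

/-- **the typed weight**: `b` (think `g₂ᴮ`) on species B, `a` (think `g₂ᴬ`) on species A. [cite: BalabanImbrieJaffe1988, (5.13.4) p.306] -/
def twt (a b : Finset ι → R) : Finset ι × Bool → R
  | (X, true) => b X
  | (X, false) => a X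

/-- **the typed family of a two-species configuration** `(Q, M)`: the species-B polymers `M` tagged `true`, the species-A polymers of `Q ∖ M`
which are not a single elementary region tagged `false` (the single regions of species A are dropped into the background).
[cite: BalabanImbrieJaffe1988, (5.13.4) p.306] -/
def toGas (Q M : Finset (Finset ι)) : Finset (Finset ι × Bool) :=
  M.image (fun X => (X, true)) ∪ ((Q \ M).filter fun X => X ∉ regions J₀ W).image fun X => (X, false)

/-- **the filling of a typed family**: its supports together with the uncovered elementary regions. [cite: BalabanImbrieJaffe1988, (5.13.4) p.306] -/
def ofQ (𝒳 : Finset (Finset ι × Bool)) : Finset (Finset ι) := 𝒳.image Prod.fst ∪ uncov J₀ W 𝒳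

/-- **the species-B family of a typed family**: the supports of its members of species B. [cite: BalabanImbrieJaffe1988, (5.13.4) p.306] -/
def ofM (𝒳 : Finset (Finset ι × Bool)) : Finset (Finset ι) := (𝒳.filter fun p => p.2 = true).image Prod.fst

variable {adj J₀ W}

omit [DecidableEq ι] [DecidableRel adj] in
/-- the incompatibility is REFLEXIVE (hypothesis `hrefl` of the abstract polymer-gas estimates). [cite: BalabanImbrieJaffe1988, (5.13.4) p.306] -/
theorem tinc_refl (p : Finset ι × Bool) : tinc adj p p := Or.inl rfl

omit [DecidableEq ι] [DecidableRel adj] in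
/-- abutting is symmetric. [cite: BalabanImbrieJaffe1988, (5.13.4) p.306] -/
theorem touch_symm {X X' : Finset ι} (h : Touch adj X X') : Touch adj X' X := by
  obtain ⟨a, ha, b, hb, hab⟩ := h
  exact ⟨b, hb, a, ha, hab.symm⟩

omit [DecidableEq ι] [DecidableRel adj] in
/-- the incompatibility is SYMMETRIC (hypothesis `hsymm` of the abstract polymer-gas estimates). [cite: BalabanImbrieJaffe1988, (5.13.4) p.306] -/
theorem tinc_symm {p q : Finset ι × Bool} (h : tinc adj p q) : tinc adj q p := by
  rcases h with h | h | ⟨hp, hq, ht⟩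
  · exact Or.inl h.symm
  · exact Or.inr (Or.inl fun hd => h hd.symm)
  · exact Or.inr (Or.inr ⟨hq, hp, touch_symm ht⟩)

/-- membership in the closed polymers. [cite: BalabanImbrieJaffe1988, (5.13.4) p.306] -/
theorem mem_cpolys {X : Finset ι} : X ∈ cpolys J₀ W ↔ X ⊆ W ∧ X.Nonempty ∧ IsClosed J₀ W X := by
  rw [cpolys, mem_filter, mem_powerset]

/-- membership in the typed polymers. [cite: BalabanImbrieJaffe1988, (5.13.4) p.306] -/
theorem mem_tpolys {p : Finset ι × Bool} :
    p ∈ tpolys J₀ W ↔ (p.1 ⊆ W ∧ p.1.Nonempty ∧ IsClosed J₀ W p.1) ∧ (p.2 = true ∨ p.1 ∉ regions J₀ W) := by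
  simp only [tpolys, cpolys, mem_filter, mem_product, mem_powerset, mem_univ, and_true]

/-- membership in the uncovered regions. [cite: BalabanImbrieJaffe1988, (5.13.4) p.306] -/
theorem mem_uncov {𝒳 : Finset (Finset ι × Bool)} {E : Finset ι} :
    E ∈ uncov J₀ W 𝒳 ↔ E ∈ regions J₀ W ∧ ∀ p ∈ 𝒳, Disjoint E p.1 := mem_filter

omit [DecidableEq ι] [CommRing R] in
/-- the typed weight on species B. [cite: BalabanImbrieJaffe1988, (5.13.4) p.306] -/
@[simp] theorem twt_true (a b : Finset ι → R) (X : Finset ι) : twt a b (X, true) = b X := rfl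

omit [DecidableEq ι] [CommRing R] in
/-- the typed weight on species A. [cite: BalabanImbrieJaffe1988, (5.13.4) p.306] -/
@[simp] theorem twt_false (a b : Finset ι → R) (X : Finset ι) : twt a b (X, false) = a X := rfl

/-! ## §2 The bijection between two-species configurations and compatible typed families -/

/-- the members of the typed family of `(Q, M)`. [cite: BalabanImbrieJaffe1988, (5.13.4) p.306] -/
theorem mem_toGas {Q M : Finset (Finset ι)} {p : Finset ι × Bool} (hp : p ∈ toGas J₀ W Q M) :
    (p.1 ∈ M ∧ p.2 = true) ∨ (p.1 ∈ Q ∧ p.1 ∉ M ∧ p.1 ∉ regions J₀ W ∧ p.2 = false) := by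
  rcases mem_union.1 hp with h | h
  · obtain ⟨X, hX, rfl⟩ := mem_image.1 h
    exact Or.inl ⟨hX, rfl⟩
  · obtain ⟨X, hX, rfl⟩ := mem_image.1 h
    obtain ⟨hXQ, hXr⟩ := mem_filter.1 hX
    exact Or.inr ⟨(mem_sdiff.1 hXQ).1, (mem_sdiff.1 hXQ).2, hXr, rfl⟩

/-- the support of a member of the typed family of `(Q, M)` is a polymer of `Q`, of species B iff tagged `true`.
[cite: BalabanImbrieJaffe1988, (5.13.4) p.306] -/
theorem fst_mem_of_mem_toGas {Q M : Finset (Finset ι)} (hMQ : M ⊆ Q) {p : Finset ι × Bool} (hp : p ∈ toGas J₀ W Q M) :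
    p.1 ∈ Q ∧ (p.2 = true ↔ p.1 ∈ M) := by
  rcases mem_toGas hp with ⟨hM, h2⟩ | ⟨hQ, hM, -, h2⟩
  · exact ⟨hMQ hM, iff_of_true h2 hM⟩
  · refine ⟨hQ, iff_of_false ?_ hM⟩
    rw [h2]
    exact Bool.false_ne_true

/-- the typed family of a two-species configuration consists of typed polymers. [cite: BalabanImbrieJaffe1988, (5.13.4) p.306] -/
theorem toGas_subset_tpolys {Q M : Finset (Finset ι)} (hQ : IsSetPartition W Q) (hcl : ∀ X ∈ Q, IsClosed J₀ W X) (hMQ : M ⊆ Q) :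
    toGas J₀ W Q M ⊆ tpolys J₀ W := by
  intro p hp
  rw [mem_tpolys]
  rcases mem_toGas hp with ⟨hM, h2⟩ | ⟨hpQ, -, hr, -⟩
  · exact ⟨⟨hQ.subset (hMQ hM), hQ.nonempty_of_mem (hMQ hM), hcl _ (hMQ hM)⟩, Or.inl h2⟩
  · exact ⟨⟨hQ.subset hpQ, hQ.nonempty_of_mem hpQ, hcl _ hpQ⟩, Or.inr hr⟩

omit [DecidableRel adj] in
/-- **the typed family of a two-species configuration is COMPATIBLE**: distinct polymers of a filling are disjoint, and the hard core on `M` is the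
B–B clause. [cite: BalabanImbrieJaffe1988, (5.13.4) p.306] -/
theorem isCompatible_toGas {Q M : Finset (Finset ι)} (hQ : IsSetPartition W Q) (hMQ : M ⊆ Q) (hM : HardCore adj M) :
    IsCompatible (tinc adj) (toGas J₀ W Q M) := by
  intro p hp q hq hne
  obtain ⟨hpQ, hp2⟩ := fst_mem_of_mem_toGas hMQ (mem_coe.1 hp)
  obtain ⟨hqQ, hq2⟩ := fst_mem_of_mem_toGas hMQ (mem_coe.1 hq)
  have hne1 : p.1 ≠ q.1 := by
    intro h1
    apply hne
    refine Prod.ext h1 (Bool.eq_iff_iff.2 ?_)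
    rw [hp2, hq2, h1]
  have hdis : Disjoint p.1 q.1 := hQ.disjoint hpQ hqQ hne1
  rintro (h | h | ⟨hpt, hqt, a, ha, b, hb, hab⟩)
  · exact hne1 h
  · exact h hdis
  · have hpM : p.1 ∈ M := hp2.1 hpt
    have hqM : q.1 ∈ M := hq2.1 hqt
    rcases hab with hab | hab
    · exact hM p.1 hpM q.1 hqM hne1 a ha b hb hab
    · exact hM q.1 hqM p.1 hpM hne1.symm b hb a ha hab

/-- **the uncovered regions of the typed family of `(Q, M)` are the single-region polymers of species A.**
[cite: BalabanImbrieJaffe1988, (5.13.4) p.306] -/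
theorem uncov_toGas {Q M : Finset (Finset ι)} (hQ : IsSetPartition W Q) (hMQ : M ⊆ Q) :
    uncov J₀ W (toGas J₀ W Q M) = (Q \ M).filter fun X => X ∈ regions J₀ W := by
  ext E
  rw [mem_uncov, mem_filter, mem_sdiff]
  constructor
  · rintro ⟨hEr, hdis⟩
    obtain ⟨v, hv⟩ := (isSetPartition_regions J₀ W).nonempty_of_mem hEr
    obtain ⟨X, hXQ, hvX⟩ := hQ.exists_mem ((isSetPartition_regions J₀ W).subset hEr hv)
    have key : ¬ Disjoint E X := fun h => disjoint_left.1 h hv hvX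
    have hXM : X ∉ M := fun hXM =>
      key (hdis (X, true) (mem_union.2 (Or.inl (mem_image_of_mem (fun X => (X, true)) hXM))))
    have hXr : X ∈ regions J₀ W := by
      by_contra hXr
      exact key (hdis (X, false) (mem_union.2 (Or.inr (mem_image_of_mem (fun X => (X, false))
        (mem_filter.2 ⟨mem_sdiff.2 ⟨hXQ, hXM⟩, hXr⟩)))))
    have hXE : X = E := (isSetPartition_regions J₀ W).eq_of_mem hXr hEr hvX hv
    subst hXE
    exact ⟨⟨hXQ, hXM⟩, hXr⟩
  · rintro ⟨⟨hEQ, hEM⟩, hEr⟩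
    refine ⟨hEr, fun p hp => hQ.disjoint hEQ (fst_mem_of_mem_toGas hMQ hp).1 fun hE => ?_⟩
    rcases mem_toGas hp with ⟨hM, -⟩ | ⟨-, -, hr, -⟩
    · exact hEM (hE ▸ hM)
    · exact hr (hE ▸ hEr)

/-- tagging then forgetting the tag. [cite: BalabanImbrieJaffe1988, (5.13.4) p.306] -/
theorem image_fst_image_mk (s : Finset (Finset ι)) (c : Bool) : (s.image fun X => (X, c)).image Prod.fst = s := by
  rw [image_image]
  exact image_id'

/-- **the filling is recovered from the typed family.** [cite: BalabanImbrieJaffe1988, (5.13.4) p.306] -/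
theorem ofQ_toGas {Q M : Finset (Finset ι)} (hQ : IsSetPartition W Q) (hMQ : M ⊆ Q) : ofQ J₀ W (toGas J₀ W Q M) = Q := by
  rw [ofQ, uncov_toGas hQ hMQ, toGas, image_union, image_fst_image_mk, image_fst_image_mk, union_assoc,
    union_comm ((Q \ M).filter fun X => X ∉ regions J₀ W) ((Q \ M).filter fun X => X ∈ regions J₀ W),
    filter_union_filter_not_eq, union_sdiff_of_subset hMQ]

/-- **the species-B family is recovered from the typed family.** [cite: BalabanImbrieJaffe1988, (5.13.4) p.306] -/
theorem ofM_toGas (Q M : Finset (Finset ι)) : ofM (toGas J₀ W Q M) = M := by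
  have hA : (M.image fun X => (X, true)).filter (fun p : Finset ι × Bool => p.2 = true) = M.image fun X => (X, true) :=
    filter_true_of_mem fun p hp => by
      obtain ⟨X, -, rfl⟩ := mem_image.1 hp
      rfl
  have hB : (((Q \ M).filter fun X => X ∉ regions J₀ W).image fun X => (X, false)).filter
      (fun p : Finset ι × Bool => p.2 = true) = ∅ :=
    filter_false_of_mem fun p hp => by
      obtain ⟨X, -, rfl⟩ := mem_image.1 hp
      exact Bool.false_ne_true
  rw [ofM, toGas, filter_union, hA, hB, union_empty, image_fst_image_mk]

/-- **the weights agree**: the typed weights of the typed family times the background `a` on its uncovered regions is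
`Π_{X∈M} b(X) · Π_{X∈Q∖M} a(X)`. [cite: BalabanImbrieJaffe1988, (5.13.4) p.306] -/
theorem prod_toGas_mul {Q M : Finset (Finset ι)} (hQ : IsSetPartition W Q) (hMQ : M ⊆ Q) (a b : Finset ι → R) :
    (∏ p ∈ toGas J₀ W Q M, twt a b p) * ∏ E ∈ uncov J₀ W (toGas J₀ W Q M), a E = (∏ X ∈ M, b X) * ∏ X ∈ Q \ M, a X := by
  have hdisj : Disjoint (M.image fun X => (X, true))
      (((Q \ M).filter fun X => X ∉ regions J₀ W).image fun X => (X, false)) := by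
    refine disjoint_left.2 fun p hpA hpB => ?_
    obtain ⟨X, -, rfl⟩ := mem_image.1 hpA
    obtain ⟨X', -, h⟩ := mem_image.1 hpB
    exact Bool.false_ne_true (congrArg Prod.snd h)
  have hinjT : Set.InjOn (fun X : Finset ι => (X, true)) ↑M := fun X _ X' _ h => congrArg Prod.fst h
  have hinjF : Set.InjOn (fun X : Finset ι => (X, false)) ↑((Q \ M).filter fun X => X ∉ regions J₀ W) :=
    fun X _ X' _ h => congrArg Prod.fst h
  rw [uncov_toGas hQ hMQ, toGas, prod_union hdisj, prod_image hinjT, prod_image hinjF]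
  simp only [twt_true, twt_false]
  rw [mul_assoc, prod_filter_not_mul_prod_filter]

omit [DecidableEq ι] [DecidableRel adj] in
/-- **what compatibility says about two distinct members**: distinct, disjoint supports, and not (both B and abutting).
[cite: BalabanImbrieJaffe1988, (5.13.4) p.306] -/
theorem ne_of_isCompatible {𝒳 : Finset (Finset ι × Bool)} (hc : IsCompatible (tinc adj) 𝒳) {p q : Finset ι × Bool} (hp : p ∈ 𝒳)
    (hq : q ∈ 𝒳) (hne : p ≠ q) : p.1 ≠ q.1 ∧ Disjoint p.1 q.1 ∧ ¬ (p.2 = true ∧ q.2 = true ∧ Touch adj p.1 q.1) := by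
  have h : ¬ tinc adj p q := hc hp hq hne
  simp only [tinc, not_or, not_not] at h
  exact h

omit [DecidableEq ι] [DecidableRel adj] in
/-- in a compatible typed family the support determines the member. [cite: BalabanImbrieJaffe1988, (5.13.4) p.306] -/
theorem eq_of_fst_eq {𝒳 : Finset (Finset ι × Bool)} (hc : IsCompatible (tinc adj) 𝒳) {p q : Finset ι × Bool} (hp : p ∈ 𝒳) (hq : q ∈ 𝒳)
    (h : p.1 = q.1) : p = q := by
  by_contra hne
  exact (ne_of_isCompatible hc hp hq hne).1 h

/-- the blocks of the filling of a typed family are nonempty closed sets of cubes of `W`. [cite: BalabanImbrieJaffe1988, (5.13.4) p.306] -/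
theorem nonempty_closed_of_mem_ofQ {𝒳 : Finset (Finset ι × Bool)} (h𝒳 : 𝒳 ⊆ tpolys J₀ W) {X : Finset ι} (hX : X ∈ ofQ J₀ W 𝒳) :
    X ⊆ W ∧ X.Nonempty ∧ IsClosed J₀ W X := by
  rcases mem_union.1 hX with h | h
  · obtain ⟨p, hp, rfl⟩ := mem_image.1 h
    exact (mem_tpolys.1 (h𝒳 hp)).1
  · obtain ⟨hXr, -⟩ := mem_uncov.1 h
    obtain ⟨i, -, rfl⟩ := mem_regions.1 hXr
    exact ⟨region_subset J₀ W i, (isSetPartition_regions J₀ W).nonempty_of_mem hXr, isClosed_region J₀ W i⟩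

omit [DecidableRel adj] in
/-- **the filling of a compatible typed family IS a filling** (a set partition of the cubes of `W`): the supports are disjoint, and a region not
covered by a closed support is disjoint from it. [cite: BalabanImbrieJaffe1988, (5.13.4) p.306] -/
theorem isSetPartition_ofQ {𝒳 : Finset (Finset ι × Bool)} (h𝒳 : 𝒳 ⊆ tpolys J₀ W) (hc : IsCompatible (tinc adj) 𝒳) :
    IsSetPartition W (ofQ J₀ W 𝒳) := by
  refine ⟨fun X hX => (nonempty_closed_of_mem_ofQ h𝒳 hX).1, fun h => (nonempty_closed_of_mem_ofQ h𝒳 h).2.1.ne_empty rfl,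
    fun v hv => ?_, fun X hX X' hX' v hvX hvX' => ?_⟩
  · by_cases h : ∃ p ∈ 𝒳, v ∈ p.1
    · obtain ⟨p, hp, hvp⟩ := h
      exact ⟨p.1, mem_union.2 (Or.inl (mem_image_of_mem Prod.fst hp)), hvp⟩
    · refine ⟨region J₀ W v, mem_union.2 (Or.inr (mem_uncov.2 ⟨region_mem_regions hv, fun p hp => ?_⟩)), mem_region_self hv⟩
      refine disjoint_left.2 fun w hwR hwp => h ⟨p, hp, ?_⟩
      obtain ⟨hpW, -, hpc⟩ := (mem_tpolys.1 (h𝒳 hp)).1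
      have hsub : region J₀ W w ⊆ p.1 := region_subset_of_isClosed hpW hwp hpc
      rw [region_eq_of_mem hv hwR] at hsub
      exact hsub (mem_region_self hv)
  · rcases mem_union.1 hX with h | h <;> rcases mem_union.1 hX' with h' | h'
    · obtain ⟨p, hp, rfl⟩ := mem_image.1 h
      obtain ⟨q, hq, rfl⟩ := mem_image.1 h'
      by_contra hne1
      have hne : p ≠ q := fun hpq => hne1 (by rw [hpq])
      exact (disjoint_left.1 (ne_of_isCompatible hc hp hq hne).2.1 hvX hvX').elim
    · obtain ⟨p, hp, rfl⟩ := mem_image.1 h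
      exact (disjoint_left.1 ((mem_uncov.1 h').2 p hp) hvX' hvX).elim
    · obtain ⟨q, hq, rfl⟩ := mem_image.1 h'
      exact (disjoint_left.1 ((mem_uncov.1 h).2 q hq) hvX hvX').elim
    · exact (isSetPartition_regions J₀ W).eq_of_mem (mem_uncov.1 h).1 (mem_uncov.1 h').1 hvX hvX'

/-- the species-B family lies in the filling. [cite: BalabanImbrieJaffe1988, (5.13.4) p.306] -/
theorem ofM_subset_ofQ (𝒳 : Finset (Finset ι × Bool)) : ofM 𝒳 ⊆ ofQ J₀ W 𝒳 := fun _ hX =>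
  mem_union.2 (Or.inl (image_subset_image (filter_subset _ _) hX))

omit [DecidableRel adj] in
/-- **the species-B family of a compatible typed family satisfies the hard core** (the B–B clause of `tinc`).
[cite: BalabanImbrieJaffe1988, (5.13.4) p.306] -/
theorem hardCore_ofM {𝒳 : Finset (Finset ι × Bool)} (hc : IsCompatible (tinc adj) 𝒳) : HardCore adj (ofM 𝒳) := by
  intro X hX X' hX' hne a ha b hb hab
  obtain ⟨p, hp, rfl⟩ := mem_image.1 hX
  obtain ⟨q, hq, rfl⟩ := mem_image.1 hX'
  obtain ⟨hp, hp2⟩ := mem_filter.1 hp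
  obtain ⟨hq, hq2⟩ := mem_filter.1 hq
  have hpq : p ≠ q := fun h => hne (by rw [h])
  exact (ne_of_isCompatible hc hp hq hpq).2.2 ⟨hp2, hq2, a, ha, b, hb, Or.inl hab⟩

omit [DecidableRel adj] in
/-- **the typed family is recovered from its filling and species-B family.** [cite: BalabanImbrieJaffe1988, (5.13.4) p.306] -/
theorem toGas_ofQ_ofM {𝒳 : Finset (Finset ι × Bool)} (h𝒳 : 𝒳 ⊆ tpolys J₀ W) (hc : IsCompatible (tinc adj) 𝒳) :
    toGas J₀ W (ofQ J₀ W 𝒳) (ofM 𝒳) = 𝒳 := by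
  ext p
  constructor
  · intro hp
    rcases mem_toGas hp with ⟨hM, h2⟩ | ⟨hQ, hM, hr, h2⟩
    · obtain ⟨q, hq, hq1⟩ := mem_image.1 hM
      obtain ⟨hq, hq2⟩ := mem_filter.1 hq
      have hpq : p = q := Prod.ext hq1.symm (h2.trans hq2.symm)
      rw [hpq]
      exact hq
    · rcases mem_union.1 hQ with h | h
      · obtain ⟨q, hq, hq1⟩ := mem_image.1 h
        by_cases hq2 : q.2 = true
        · exact (hM (mem_image.2 ⟨q, mem_filter.2 ⟨hq, hq2⟩, hq1⟩)).elim
        · have hpq : p = q := Prod.ext hq1.symm (h2.trans (eq_false_of_ne_true hq2).symm)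
          rw [hpq]
          exact hq
      · exact (hr (mem_uncov.1 h).1).elim
  · intro hp
    obtain ⟨-, h2r⟩ := mem_tpolys.1 (h𝒳 hp)
    by_cases h2 : p.2 = true
    · exact mem_union.2 (Or.inl (mem_image.2 ⟨p.1, mem_image.2 ⟨p, mem_filter.2 ⟨hp, h2⟩, rfl⟩, Prod.ext rfl h2.symm⟩))
    · have hr : p.1 ∉ regions J₀ W := h2r.resolve_left h2
      have hM : p.1 ∉ ofM 𝒳 := by
        intro h
        obtain ⟨q, hq, hq1⟩ := mem_image.1 h
        obtain ⟨hq, hq2⟩ := mem_filter.1 hq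
        rw [eq_of_fst_eq hc hq hp hq1] at hq2
        exact h2 hq2
      exact mem_union.2 (Or.inr (mem_image.2 ⟨p.1, mem_filter.2 ⟨mem_sdiff.2
        ⟨mem_union.2 (Or.inl (mem_image_of_mem Prod.fst hp)), hM⟩, hr⟩, Prod.ext rfl (eq_false_of_ne_true h2).symm⟩))

end Gas

end Literature.MathematicalPhysics.QuantumFieldTheory.BalabanImbrieJaffe1984to88.BIJ88TwoSpeciesPolymerGas
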